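import Summits.CriticalPhenomena.PercolationContinuityZ3.Theorems.PercNearOneGluingNoHeavyLowerTailQ44bCrossPendantExchange
import Literature.Probability.Percolation.FourFunctionsProdBernoulli
import HarnessLib

/-!
# Pendant–crossing log-supermodularity: `P(a|bcy) · P(ac|by) ≤ P(abcy) · P(a|by|c)` (all `n`, all weights)

Support file for crux `stmt-CriticalPhenomena-4575` (master-family programme, the `Q44b` / `ND_a` line), seat
`prim-l12-p6` gen 7; memo `run/shared/lean/prim/prim-l12/FROM-prim-l12-p6-g7-Q44B-PENCIL-CONCAVITY.md` §3b.

Bond percolation `μ = prodBernoulli w` on a finite vertex type, four vertices `a b c y`, `P(π)` the probability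
of the partition `π` of `{a,b,c,y}` induced by the open clusters.  The pair `(a|bcy, ac|by)` has meet `a|by|c`
and join `abcy` in the partition lattice, and the LEAK-FREE log-supermodularity

  `pendantCrossing`:   `P(a|bcy) · P(ac|by) ≤ P(abcy) · P(a|by|c)`

holds for every finite weighted graph (the four-functions theorem alone gives only the leaky bound
`P(a|bcy)P(ac|by) ≤ P(abcy)·[P(a|by|c) + P(∅)]`).  Read as conditional probabilities: the cluster of `{a,c}` is
more likely to meet the cluster of `{b,y}` than the cluster of `c` alone is when it must in addition avoid `a`.
It is the four-point shadow (vertex `a` of the memo deleted) of the open 5-point exchange `H1` of the `ND_a`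
decomposition (memo §2).

Proof: (AD) the four-events inequality for `𝒜 = {a|bcy}`, `ℬ = D ∩ {a~c} = {ac|by, ac|b|y}` with
`D = {a,c} ↮ {b,y}`: `P(a|bcy) · μ(D ∩ ac) ≤ P(abcy) · μ(D ∩ ¬ac)` (`μ(D ∩ ¬ac) = P(∅) + P(a|by|c)`);
(BHK) van den Berg–Häggström–Kahn two-set conditional association on `D` with `S = {a,c}`, `T = {b,y}`:
`μ(D∩ac∩by)·μ(D) ≤ μ(D∩ac)·μ(D∩by)`; bookkeeping `P(ac|by) = μ(D∩ac∩by)`,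
`P(a|by|c) = μ(D∩by) − μ(D∩ac∩by)`.  Theorems only; standard axioms.
-/

namespace Summit.CriticalPhenomena.PercolationContinuityZ3.Theorems

namespace Q44bExchange

open MeasureTheory Set
open Literature.Probability.LatticeModels (prodBernoulli)
open Literature.Probability.Percolation

variable {V : Type*} [Fintype V]

/-- **(AD step)** `P(a|bcy) · μ({a,c}↮{b,y} ∧ a~c) ≤ P(a~b ∧ a~c ∧ a~y) · μ({a,c}↮{b,y} ∧ a≁c)`: a configuration of
`a|bcy` and one of `{ac|by, ac|b|y}` intersect in one where `a, c` are separated from everything and unite in one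
where `a~b~c~y`. [this work] -/
theorem pendantCrossing_ad (w : Sym2 V → unitInterval) (a b c y : V) :
    (prodBernoulli w).real ((openConn a b)ᶜ ∩ (openConn a c)ᶜ ∩ (openConn a y)ᶜ ∩ openConn b c ∩ openConn b y) *
        (prodBernoulli w).real ((openConn a b)ᶜ ∩ (openConn a y)ᶜ ∩ (openConn c b)ᶜ ∩ (openConn c y)ᶜ ∩
          openConn a c) ≤
      (prodBernoulli w).real (openConn a b ∩ openConn a c ∩ openConn a y) *
        (prodBernoulli w).real ((openConn a b)ᶜ ∩ (openConn a y)ᶜ ∩ (openConn c b)ᶜ ∩ (openConn c y)ᶜ ∩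
          (openConn a c)ᶜ) := by
  -- four functions with the INTERSECTION target first: μ(A)μ(B) ≤ μ(meet-target)μ(join-target)
  have key := prodBernoulli_fourEvents w
    ((openConn a b)ᶜ ∩ (openConn a c)ᶜ ∩ (openConn a y)ᶜ ∩ openConn b c ∩ openConn b y)
    ((openConn a b)ᶜ ∩ (openConn a y)ᶜ ∩ (openConn c b)ᶜ ∩ (openConn c y)ᶜ ∩ openConn a c)
    ((openConn a b)ᶜ ∩ (openConn a y)ᶜ ∩ (openConn c b)ᶜ ∩ (openConn c y)ᶜ ∩ (openConn a c)ᶜ)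
    (openConn a b ∩ openConn a c ∩ openConn a y) (fun ω hω ω' hω' => ?_)
  · rw [mul_comm ((prodBernoulli w).real (openConn a b ∩ openConn a c ∩ openConn a y))]
    exact key
  have mem : ∀ (ω : BondConfig V) (u v : V),
      ω ∈ (openConn u v : Set (BondConfig V)) ↔ (openGraph ω).Reachable u v := fun _ _ _ => Iff.rfl
  simp only [mem_inter_iff, mem_compl_iff, mem] at hω hω' ⊢
  obtain ⟨⟨⟨⟨hab, hac⟩, hay⟩, hbc⟩, hby⟩ := hω
  obtain ⟨⟨⟨⟨hab', hay'⟩, hcb'⟩, hcy'⟩, hac'⟩ := hω'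
  have la : ∀ {u v : V}, (openGraph (ω ∩ ω')).Reachable u v → (openGraph ω).Reachable u v :=
    fun h => h.mono (BHK2006.openGraph_le inter_subset_left)
  have lb : ∀ {u v : V}, (openGraph (ω ∩ ω')).Reachable u v → (openGraph ω').Reachable u v :=
    fun h => h.mono (BHK2006.openGraph_le inter_subset_right)
  have ua : ∀ {u v : V}, (openGraph ω).Reachable u v → (openGraph (ω ∪ ω')).Reachable u v :=
    fun h => h.mono (BHK2006.openGraph_le subset_union_left)
  have ub : ∀ {u v : V}, (openGraph ω').Reachable u v → (openGraph (ω ∪ ω')).Reachable u v :=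
    fun h => h.mono (BHK2006.openGraph_le subset_union_right)
  refine ⟨⟨⟨⟨⟨fun h => hab (la h), fun h => hay (la h)⟩, fun h => hcb' (lb h)⟩, fun h => hcy' (lb h)⟩,
    fun h => hac (la h)⟩, ⟨?_, ub hac'⟩, ?_⟩
  · exact (ub hac').trans ((ua hbc).symm)
  · exact ((ub hac').trans (ua hbc).symm).trans (ua hby)

/-- **(BHK step)** given `D = {a,c} ↮ {b,y}`, the events `{a~c}` (a function of `C_{a,c}`) and `{b~y}` (a function of
`C_{b,y}`) are negatively correlated: `μ(D∩ac∩by)·μ(D) ≤ μ(D∩ac)·μ(D∩by)`.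
[cite: VandenbergHaggstromKahn2005, Thm. 2.1 (p. 9) at q = 1 — corollary] -/
theorem pendantCrossing_bhk (w : Sym2 V → unitInterval) (a b c y : V) :
    (prodBernoulli w).real ((openConn a b)ᶜ ∩ (openConn a y)ᶜ ∩ (openConn c b)ᶜ ∩ (openConn c y)ᶜ ∩
          (openConn a c ∩ openConn b y)) *
        (prodBernoulli w).real ((openConn a b)ᶜ ∩ (openConn a y)ᶜ ∩ (openConn c b)ᶜ ∩ (openConn c y)ᶜ) ≤
      (prodBernoulli w).real ((openConn a b)ᶜ ∩ (openConn a y)ᶜ ∩ (openConn c b)ᶜ ∩ (openConn c y)ᶜ ∩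
          openConn a c) *
        (prodBernoulli w).real ((openConn a b)ᶜ ∩ (openConn a y)ᶜ ∩ (openConn c b)ᶜ ∩ (openConn c y)ᶜ ∩
          openConn b y) := by
  classical
  have ha : a ∈ ({a, c} : Set V) := by simp
  have hb : b ∈ ({b, y} : Set V) := by simp
  have key := setClusterEventExchange w ({a, c} : Set V) ({b, y} : Set V)
    (fun C => (SimpleGraph.fromEdgeSet C).Reachable a c) (fun _ => True)
    (fun C => (SimpleGraph.fromEdgeSet C).Reachable b y) (fun _ => True)
    (PathExchange.reachIn_mono a c) (fun _ _ _ h => h)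
    (PathExchange.reachIn_mono b y) (fun _ _ _ h => h)
  have hD : {ω : BondConfig V | ∀ s ∈ ({a, c} : Set V), ∀ t ∈ ({b, y} : Set V),
      ¬ (openGraph ω).Reachable s t} =
        (openConn a b)ᶜ ∩ (openConn a y)ᶜ ∩ (openConn c b)ᶜ ∩ (openConn c y)ᶜ := by
    ext ω
    simp only [mem_setOf_eq, mem_insert_iff, mem_singleton_iff, forall_eq_or_imp, forall_eq,
      mem_inter_iff, mem_compl_iff, openConn]
    tauto
  simp only [setOf_fromEdgeSet_biUnion_reachable _ ha, setOf_fromEdgeSet_biUnion_reachable _ hb,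
    setOf_true, inter_univ, hD] at key
  exact key

/-- **Pendant–crossing log-supermodularity (all `n`, all weights).**  For `μ = prodBernoulli w` and vertices
`a b c y`:  `P(a|bcy) · P(ac|by) ≤ P(abcy) · P(a|by|c)`, the cells written as
`a|bcy = {a≁b,a≁c,a≁y,b~c,b~y}`, `ac|by = {a≁b,a≁y,c≁b,c≁y, a~c, b~y}`, `abcy = {a~b,a~c,a~y}`,
`a|by|c = {a≁b,a≁y,c≁b,c≁y, a≁c, b~y}`.  Proof: `pendantCrossing_ad`, `pendantCrossing_bhk` and bookkeeping. [this work] -/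
theorem pendantCrossing (w : Sym2 V → unitInterval) (a b c y : V) :
    (prodBernoulli w).real ((openConn a b)ᶜ ∩ (openConn a c)ᶜ ∩ (openConn a y)ᶜ ∩ openConn b c ∩ openConn b y) *
        (prodBernoulli w).real ((openConn a b)ᶜ ∩ (openConn a y)ᶜ ∩ (openConn c b)ᶜ ∩ (openConn c y)ᶜ ∩
          (openConn a c ∩ openConn b y)) ≤
      (prodBernoulli w).real (openConn a b ∩ openConn a c ∩ openConn a y) *
        (prodBernoulli w).real ((openConn a b)ᶜ ∩ (openConn a y)ᶜ ∩ (openConn c b)ᶜ ∩ (openConn c y)ᶜ ∩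
          ((openConn a c)ᶜ ∩ openConn b y)) := by
  classical
  set μ := prodBernoulli w with hμ
  set D : Set (BondConfig V) := (openConn a b)ᶜ ∩ (openConn a y)ᶜ ∩ (openConn c b)ᶜ ∩ (openConn c y)ᶜ with hD
  set Ac : Set (BondConfig V) := openConn a c with hAc
  set By : Set (BondConfig V) := openConn b y with hBy
  set Pd : Set (BondConfig V) :=
    (openConn a b)ᶜ ∩ (openConn a c)ᶜ ∩ (openConn a y)ᶜ ∩ openConn b c ∩ openConn b y with hPd
  set Al : Set (BondConfig V) := openConn a b ∩ openConn a c ∩ openConn a y with hAl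
  have hA := pendantCrossing_ad w a b c y
  have hB := pendantCrossing_bhk w a b c y
  simp only [← hμ, ← hD, ← hAc, ← hBy] at hA hB
  -- names for the reals
  set P1 := μ.real Pd
  set P4 := μ.real Al
  set α := μ.real (D ∩ (Ac ∩ By))
  set γ := μ.real (D ∩ Ac)
  set δ := μ.real D
  set m := μ.real (D ∩ By)
  have hmeas : ∀ s : Set (BondConfig V), MeasurableSet s := fun _ => MeasurableSet.of_discrete
  -- bookkeeping: μ(D ∩ Acᶜ) = δ − γ and μ(D ∩ (Acᶜ ∩ By)) = m − α
  have e1 : μ.real (D ∩ Acᶜ) = δ - γ := by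
    have h := measureReal_inter_add_sdiff (μ := μ) (s := D) (hmeas Ac)
    rw [sdiff_eq] at h
    linarith
  have e2 : μ.real (D ∩ (Acᶜ ∩ By)) = m - α := by
    have h := measureReal_inter_add_sdiff (μ := μ) (s := D ∩ By) (hmeas Ac)
    have hset1 : D ∩ By ∩ Ac = D ∩ (Ac ∩ By) := by
      ext ω; simp only [mem_inter_iff]; tauto
    have hset2 : (D ∩ By) \ Ac = D ∩ (Acᶜ ∩ By) := by
      ext ω; simp only [mem_sdiff, mem_inter_iff, mem_compl_iff]; tauto
    rw [hset1, hset2] at h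
    linarith
  rw [e1] at hA
  rw [e2]
  have hα : 0 ≤ α := measureReal_nonneg
  have hγ : 0 ≤ γ := measureReal_nonneg
  have hδ : 0 ≤ δ := measureReal_nonneg
  have hP1 : 0 ≤ P1 := measureReal_nonneg
  have hP4 : 0 ≤ P4 := measureReal_nonneg
  have hαδ : α ≤ δ := measureReal_mono inter_subset_left
  -- hA : P1 * γ ≤ P4 * (δ - γ);  hB : α * δ ≤ γ * m.  Goal: P1 * α ≤ P4 * (m - α).
  have hmain : δ * (P1 * α) ≤ δ * (P4 * (m - α)) := by
    have h1 : P1 * (α * δ) ≤ P1 * (γ * m) := mul_le_mul_of_nonneg_left hB hP1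
    have h2 : m * (P1 * γ) ≤ m * (P4 * (δ - γ)) := mul_le_mul_of_nonneg_left hA measureReal_nonneg
    nlinarith
  rcases hδ.eq_or_lt with h0 | hpos
  · have hα0 : α = 0 := le_antisymm (h0 ▸ hαδ) hα
    have hm : α ≤ m := measureReal_mono (inter_subset_inter_right _ inter_subset_right)
    rw [hα0]
    nlinarith [hm]
  · exact le_of_mul_le_mul_left hmain hpos

end Q44bExchange

end Summit.CriticalPhenomena.PercolationContinuityZ3.Theorems
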